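import Summits.BirchSwinnertonDyer.BirchSwinnertonDyer.Theorems.AlignedTransportAtTwoMainConjectureTransportAlignedAtTwoDeltaPosFunctional
import Literature.NumberTheory.EllipticCurves.NewformsDepletion
import Literature.NumberTheory.EllipticCurves.ModularSymbolsPeriodHomology
import HarnessLib

/-!
# Crux C1 `MainConjectureTransportAlignedAtTwo` (stmt-BirchSwinnertonDyer-22296), line `birth`, plan «deltapos-galois» step (K2) AT THE DEPLETED LEVEL:
# THE MOD-2 DEPLETED PLUS FUNCTIONAL IS STILL THE PAIRING WITH `T*` — for `x ∈ H₁(X₀(N');ℤ)`, `N∏ℓ² ∣ N'`, the integer `n` with `n·Ω⁺_f = 2·D_S·re x(g)`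
# is EVEN iff `u_W(c·D_S·x(g)/2) ∈ {O, T*}` (width seat att-p4 g13; `--supports 22296`)

THEOREMS ONLY (no `def`, no `sorry`, no named fact). BSD is not proved by this; C1 is not closed by this.

Context (`Cruxes/MainConjectureTransportAlignedAtTwo/Lines/birth-deltapos-galois-plan.md` (G4); memo `DELTA-POS-ENGINE-att-p4-g13.md` §3(b)). The lead's (K2)
`…DeltaPosFunctional.even_plusValue_iff_uniformize_half` (p664803) reads the mod-`2` plus functional `n(x) = (2/Ω⁺_f)·re x(f)`, `x ∈ H₁(X₀(N);ℤ)`, as the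
Weil pairing with `T* = u_W(iΩ₀'/2)`; its proof uses the cycle `x` ONLY through `c·x(f) ∈ Λ_E` (`maninConstant_mul_eval_mem`). For UNEQUAL conductors the
engine `…DeltaPosEngine.lamLaw_of_depleted_periodFunctionals_congr` (p666668) wants the congruence of the DEPLETED functionals
`n_S(x) = (2D_S/Ω⁺_f)·re x(g)` (`D_S = ∏_{ℓ∈S} ℓ²`, `g` the `S`-depleted form at a level `N'` with `N∏ℓ² ∣ N'`, `x ∈ H₁(X₀(N');ℤ)`), and
`D_S·x(g) ∈ Λ_f` (`DepletedForm.mul_mem_periodLattice_of_mem_periodLattice_depleted`, Atkin–Lehner). Hence: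

* `even_plusValue_iff_half_mem_or_sub_halfPeriodI_mem_of_mul_mem` / `even_plusValue_iff_uniformize_half_of_mul_mem` (§1, (K2′)): (K2) for ANY `y ∈ ℂ`
  with `c·y ∈ Λ_E` in place of `x(f)` — `Even n ↔ u_W(c·y/2) ∈ {O, T*}` for `n·Ω⁺_f = 2·re y` (the lead's proof verbatim);
* `maninConstant_mul_prodSq_mul_eval_depleted_mem` (§2): `c·D_S·x(g) ∈ Λ_E` for `x ∈ H₁(X₀(N');ℤ)`;
* **`even_depletedPlusValue_iff_uniformize_half`** (§2): `Even n ↔ u_W(c·D_S·x(g)/2) = O ∨ u_W(c·D_S·x(g)/2) = u_W(iΩ₀'/2)` for `n·Ω⁺_f = 2·D_S·re x(g)`,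
  and the engine-currency form **`even_depletedPlusValue_iff_uniformize_half'`** with `(2D_S/Ω⁺_f)·re x(g) = n` (the hypothesis shape of
  `…OrdPlusLineTools.exists_int_depleted_periodFunctional` / `…DeltaPosEngine`).

So on the depleted level the Galois step (G1) needs the `G_ℚ`-equivariance of `[x] ↦ u_W(c·D_S·x(g))` on `J₀(N')[2]` — the sum `Σ_d c_d(D_S/d)·ψ(π_{d*}x)` of
algebraic maps (typing ask T2), or directly the carrier's `jacobiMap_galAct` typed for the generalised datum `(W, g, c·D_S)` (memo §3(b), T1⁺).

References: Cremona 1997 §2.8, §2.10 [CremonaAlgorithms1997]; Atkin–Lehner 1970 §3 [AtkinLehner1970]; Abbes–Ullmo 1996 Thm A [AbbesUllmo1996].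
-/

noncomputable section

-- justification: the `Summit.BirchSwinnertonDyer.BirchSwinnertonDyer.…` path repeats a component (route-file convention)
set_option linter.dupNamespace false
set_option autoImplicit false

open scoped ComplexConjugate ModularForm
open Complex Set PeriodPair CongruenceSubgroup
open Literature.NumberTheory.EllipticCurves Literature.NumberTheory.EllipticCurves.ModularForms
open Summit.BirchSwinnertonDyer.BirchSwinnertonDyer.Theorems.AlignedTransportAtTwoDeltaPosFunctional

namespace Summit.BirchSwinnertonDyer.BirchSwinnertonDyer.Theorems.AlignedTransportAtTwoDeltaPosFunctionalDepleted

variable {W : WeierstrassCurve ℚ} [W.IsElliptic] {N : ℕ} [NeZero N] (D : ModularParametrizationData W N)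

/-! ## §1 (K2′) The mod-2 plus functional is the pairing with `T*` — for any `y` with `c·y ∈ Λ_E` -/

/-- **(K2′) lattice form.** `D` a parametrisation datum of `W` with `Δ(W) > 0` and ODD Manin constant `c`; `Ω(W) = u·Ω⁺_f`, `‖u‖₂ = 1`; `y ∈ ℂ` with `c·y ∈ Λ_E`
and `n ∈ ℤ` with `n·Ω⁺_f = 2·re y`. Then `n` is even iff `c·y/2 ∈ Λ_E` or `c·y/2 − w ∈ Λ_E`, `w = iΩ₀'/2`. (The lead's (K2) is `y = x(f)`.)
[cite: CremonaAlgorithms1997, §2.8 (p. 26), §2.10] [cite: AbbesUllmo1996, Thm. A] -/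
theorem even_plusValue_iff_half_mem_or_sub_halfPeriodI_mem_of_mul_mem (hΔ : 0 < W.Δ) (hc : Odd D.c) {u : ℚ} (hu : ‖(u : ℚ_[2])‖ = 1)
    (hΩ : W.realPeriodRat = u * plusPeriod D.f) {y : ℂ} (hy : (D.c : ℂ) * y ∈ D.L.lattice)
    {n : ℤ} (hn : (n : ℝ) * plusPeriod D.f = 2 * y.re) :
    Even n ↔ ((D.c : ℂ) * y / 2 ∈ D.L.lattice ∨
      (D.c : ℂ) * y / 2 - I * ((((D.L.mulLeft I I_ne_zero).minRealPeriod / 2 : ℝ)) : ℂ) ∈ D.L.lattice) := by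
  have hreal := D.isReal_neronLattice
  have hdisc := discr_pos_of_Δ_pos D hΔ
  have hΩpos : 0 < D.L.minRealPeriod := hreal.minRealPeriod_pos
  obtain ⟨a, k, hak⟩ := exists_eq_int_mul_add_int_mul_of_discr_pos hreal hdisc hy
  rw [hak, half_mem_or_sub_halfPeriodI_mem_iff_even hreal hdisc]
  -- it remains: `Even n ↔ Even a`, from `a·u = c·n`
  have hre : ((D.c : ℂ) * y).re = a * D.L.minRealPeriod := by
    rw [hak]; simp
  have hre' : ((D.c : ℂ) * y).re = D.c * y.re := by
    simp [Complex.mul_re]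
  have hu0 : u ≠ 0 := by
    rintro rfl; simp at hu
  have h2 : W.realPeriodRat = 2 * D.L.minRealPeriod := realPeriodRat_eq_two_mul_of_Δ_pos D hΔ
  have hplus' : plusPeriod D.f * u = 2 * D.L.minRealPeriod := by
    have hu0' : (u : ℝ) ≠ 0 := by exact_mod_cast hu0
    rw [← h2, hΩ]; field_simp
  have key : (a : ℝ) * u = D.c * n := by
    have h1 : (a : ℝ) * D.L.minRealPeriod = D.c * y.re := by rw [← hre, hre']
    have h3 : 2 * (y.re * u) = 2 * (n * D.L.minRealPeriod) := by
      calc 2 * (y.re * u) = (n * plusPeriod D.f) * u := by rw [hn]; ring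
        _ = n * (plusPeriod D.f * u) := by ring
        _ = 2 * (n * D.L.minRealPeriod) := by rw [hplus']; ring
    have h3' : y.re * u = n * D.L.minRealPeriod := by linarith
    have h4 : D.L.minRealPeriod * ((a : ℝ) * u - D.c * n) = 0 := by
      linear_combination (u : ℝ) * h1 + (D.c : ℝ) * h3'
    rcases mul_eq_zero.mp h4 with h0 | h0
    · exact absurd h0 hΩpos.ne'
    · linarith
  have key' : (a : ℚ) * u = D.c * n := by exact_mod_cast key
  exact (even_iff_even_of_mul_unit_eq_odd_mul hu hc key').symm

/-- **(K2′) point form.** Same hypotheses; with `u_W = D.uniformize` (kernel `Λ_E`): `n` is even iff `u_W(c·y/2) = O` or `u_W(c·y/2) = u_W(iΩ₀'/2)` (`= T*`, the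
`2`-torsion point of least abscissa, `…HalfPeriodOrdering`). [cite: CremonaAlgorithms1997, §2.8, §2.10] [cite: AbbesUllmo1996, Thm. A] -/
theorem even_plusValue_iff_uniformize_half_of_mul_mem (hΔ : 0 < W.Δ) (hc : Odd D.c) {u : ℚ} (hu : ‖(u : ℚ_[2])‖ = 1)
    (hΩ : W.realPeriodRat = u * plusPeriod D.f) {y : ℂ} (hy : (D.c : ℂ) * y ∈ D.L.lattice)
    {n : ℤ} (hn : (n : ℝ) * plusPeriod D.f = 2 * y.re) :
    Even n ↔ (D.uniformize ((D.c : ℂ) * y / 2) = 0 ∨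
      D.uniformize ((D.c : ℂ) * y / 2) = D.uniformize (I * ((((D.L.mulLeft I I_ne_zero).minRealPeriod / 2 : ℝ)) : ℂ))) := by
  rw [even_plusValue_iff_half_mem_or_sub_halfPeriodI_mem_of_mul_mem D hΔ hc hu hΩ hy hn]
  have hker : ∀ z : ℂ, D.uniformize z = 0 ↔ z ∈ D.L.lattice := fun z ↦ by
    rw [← SetLike.mem_coe, ← D.ker_uniformize, SetLike.mem_coe, AddMonoidHom.mem_ker]
  rw [hker, ← sub_eq_zero (a := D.uniformize _), ← map_sub, hker]

/-! ## §2 The depleted level: `c·D_S·x(g) ∈ Λ_E` and the depleted (K2) -/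

omit [W.IsElliptic] in
/-- **`c·D_S·x(g) ∈ Λ_E`** for the `S`-depleted form `g` of `f = D.f` at a level `N'` with `N·∏_{ℓ∈S}ℓ² ∣ N'` and a cycle `x ∈ H₁(X₀(N');ℤ)`:
`x(g) ∈ Λ_g` and `D_S·Λ_g ⊆ Λ_f` (Atkin–Lehner), `c·Λ_f ⊆ Λ_E`. [cite: AtkinLehner1970, §3] [cite: CremonaAlgorithms1997, §2.4, §2.10] -/
theorem maninConstant_mul_prodSq_mul_eval_depleted_mem
    (S : Finset ℕ) (hS : ∀ ℓ ∈ S, ℓ.Prime) (N' : ℕ) [NeZero N'] (hNL : N * ∏ ℓ ∈ S, ℓ ^ 2 ∣ N')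
    (g : CuspForm (Gamma0 N') 2) (hg : ∀ n : ℕ, cuspCoeff g n = if ∃ ℓ ∈ S, ℓ ∣ n then 0 else cuspCoeff D.f n)
    {x : Module.Dual ℂ (CuspForm (Gamma0 N') 2)} (hx : x ∈ periodHomology N') :
    (D.c : ℂ) * (((∏ ℓ ∈ S, ℓ ^ 2 : ℕ) : ℂ) * x g) ∈ D.L.lattice := by
  have hint : ∀ n : ℕ, ∃ z : ℤ, cuspCoeff D.f n = z := fun n ↦ ⟨W.LFunction n, D.isNewformOf.2 n⟩
  have hTf : ∀ (p : ℕ) (hp : p.Prime), (haveI : NeZero p := ⟨hp.ne_zero⟩; heckeT (Gamma0 N) 2 p D.f) = cuspCoeff D.f p • D.f :=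
    fun p hp ↦ by haveI : NeZero p := ⟨hp.ne_zero⟩; exact D.isNewformOf.1.heckeT_eq_coeff_smul hp
  have hxg : x g ∈ periodLattice g := by
    rw [periodLattice_eq_map_periodHomology]
    exact AddSubgroup.mem_map.mpr ⟨x, hx, rfl⟩
  exact D.smul_periodLattice_le _
    (DepletedForm.mul_mem_periodLattice_of_mem_periodLattice_depleted D.f hint hTf S hS N' hNL g hg _ hxg)

/-- **(K2) at the depleted level.** `D` a parametrisation datum of `W` (level `N`) with `Δ(W) > 0` and ODD `c`; `Ω(W) = u·Ω⁺_f`, `‖u‖₂ = 1`; `g` the `S`-depleted form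
of `f = D.f` at a level `N'` with `N·D_S ∣ N'` (`D_S = ∏_{ℓ∈S}ℓ²`); `x ∈ H₁(X₀(N');ℤ)` and `n ∈ ℤ` with `n·Ω⁺_f = 2·D_S·re x(g)`. Then `n` is even iff
`u_W(c·D_S·x(g)/2) = O` or `= u_W(iΩ₀'/2) = T*`. [cite: CremonaAlgorithms1997, §2.8, §2.10] [cite: AtkinLehner1970, §3] [cite: AbbesUllmo1996, Thm. A] -/
theorem even_depletedPlusValue_iff_uniformize_half (hΔ : 0 < W.Δ) (hc : Odd D.c) {u : ℚ} (hu : ‖(u : ℚ_[2])‖ = 1)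
    (hΩ : W.realPeriodRat = u * plusPeriod D.f)
    (S : Finset ℕ) (hS : ∀ ℓ ∈ S, ℓ.Prime) (N' : ℕ) [NeZero N'] (hNL : N * ∏ ℓ ∈ S, ℓ ^ 2 ∣ N')
    (g : CuspForm (Gamma0 N') 2) (hg : ∀ n : ℕ, cuspCoeff g n = if ∃ ℓ ∈ S, ℓ ∣ n then 0 else cuspCoeff D.f n)
    {x : Module.Dual ℂ (CuspForm (Gamma0 N') 2)} (hx : x ∈ periodHomology N')
    {n : ℤ} (hn : (n : ℝ) * plusPeriod D.f = 2 * (((∏ ℓ ∈ S, ℓ ^ 2 : ℕ) : ℝ) * (x g).re)) :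
    Even n ↔ (D.uniformize ((D.c : ℂ) * (((∏ ℓ ∈ S, ℓ ^ 2 : ℕ) : ℂ) * x g) / 2) = 0 ∨
      D.uniformize ((D.c : ℂ) * (((∏ ℓ ∈ S, ℓ ^ 2 : ℕ) : ℂ) * x g) / 2) =
        D.uniformize (I * ((((D.L.mulLeft I I_ne_zero).minRealPeriod / 2 : ℝ)) : ℂ))) := by
  refine even_plusValue_iff_uniformize_half_of_mul_mem D hΔ hc hu hΩ
    (maninConstant_mul_prodSq_mul_eval_depleted_mem D S hS N' hNL g hg hx) ?_
  rw [hn, ← Complex.ofReal_natCast, Complex.re_ofReal_mul]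

/-- **(K2) at the depleted level, engine currency.** Same, with the integer value given as `(2D_S/Ω⁺_f)·re x(g) = n` (the shape produced by
`…OrdPlusLineTools.exists_int_depleted_periodFunctional` and consumed by `…DeltaPosEngine.lamLaw_of_depleted_periodFunctionals_congr`).
[cite: CremonaAlgorithms1997, §2.8, §2.10] [cite: AtkinLehner1970, §3] -/
theorem even_depletedPlusValue_iff_uniformize_half' (hΔ : 0 < W.Δ) (hc : Odd D.c) {u : ℚ} (hu : ‖(u : ℚ_[2])‖ = 1)
    (hΩ : W.realPeriodRat = u * plusPeriod D.f)
    (S : Finset ℕ) (hS : ∀ ℓ ∈ S, ℓ.Prime) (N' : ℕ) [NeZero N'] (hNL : N * ∏ ℓ ∈ S, ℓ ^ 2 ∣ N')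
    (g : CuspForm (Gamma0 N') 2) (hg : ∀ n : ℕ, cuspCoeff g n = if ∃ ℓ ∈ S, ℓ ∣ n then 0 else cuspCoeff D.f n)
    {x : Module.Dual ℂ (CuspForm (Gamma0 N') 2)} (hx : x ∈ periodHomology N')
    {n : ℤ} (hn : (2 * ((∏ ℓ ∈ S, ℓ ^ 2 : ℕ) : ℝ) / plusPeriod D.f) * (x g).re = n) :
    Even n ↔ (D.uniformize ((D.c : ℂ) * (((∏ ℓ ∈ S, ℓ ^ 2 : ℕ) : ℂ) * x g) / 2) = 0 ∨
      D.uniformize ((D.c : ℂ) * (((∏ ℓ ∈ S, ℓ ^ 2 : ℕ) : ℂ) * x g) / 2) =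
        D.uniformize (I * ((((D.L.mulLeft I I_ne_zero).minRealPeriod / 2 : ℝ)) : ℂ))) := by
  have hΩpos : 0 < plusPeriod D.f := IsNewform0.plusPeriod_pos_holds D.isNewformOf.1 D.isNewformOf.coeffField_eq_bot
  refine even_depletedPlusValue_iff_uniformize_half D hΔ hc hu hΩ S hS N' hNL g hg hx ?_
  rw [← hn]; field_simp

end Summit.BirchSwinnertonDyer.BirchSwinnertonDyer.Theorems.AlignedTransportAtTwoDeltaPosFunctionalDepleted

end
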